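import Mathlib
import Summits.ValiantsHypothesis.ValiantsHypothesis.Theorems.GirthSidonMomentCurveElusiveResonantCover

/-!
# The depth dichotomy for 2×2 cancellations (supports `stub_swallowedInSmallSumset`,
crux `MomentCurveElusive`, item stmt-ValiantsHypothesis-6534, route GirthSidon, line `registered`)

Companion to `…NonResonantCover` (p173839) and `…ResonantCover` (p174013).  For power series
`u_a, u_b, u_c, u_d` with NONZERO constant terms over a field, and the depth
`γ = ord(u_a u_b − u_c u_d) < ∞` of a 2×2 cancellation, exactly one of the following holds
(`gadget_depth_dichotomy`):
 * CROSS-WITNESSED: `γ` equals one of the four cross distances `δ(a,c), δ(b,d), δ(a,d), δ(b,c)`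
   (`δ(x,z) = ord(u_x − u_z)`) — then `exists_small_cover_of_crossDepth` applies after relabelling;
 * RESONANT: `δ(a,c) = δ(b,d) = g₁ < γ` and `δ(a,d) = δ(b,c) = g₂ < γ` — then `γ = g₁ + g₂` is the
   product-depth class of `exists_small_cover_of_prodDepth`, and `γ ≠ g₁ + g₂` (linear depth / deep ties)
   is the residual of the cover statement inside 2×2-initiated targets.
Proof: the two cross forms `u_b(u_a − u_c) + u_c(u_b − u_d)` and `u_a(u_b − u_c) + u_c(u_a − u_d)` of the
cancellation; multiplying by a unit keeps orders; a sum of two terms of different orders has the smaller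
order (`order_add_of_order_ne`).  No characteristic hypothesis is needed.
-/

-- (Sub = Summit), so the duplicated namespace component is intended.
set_option linter.dupNamespace false

namespace Summit.ValiantsHypothesis.ValiantsHypothesis.Theorems

open PowerSeries Finset

section Dichotomy

variable {K : Type*} [Field K]

/-- Multiplying by a power series with nonzero constant term keeps the order. [folklore] -/
theorem order_mul_of_constantCoeff_ne_zero (v p : K⟦X⟧) (hv : constantCoeff v ≠ 0) :
    (v * p).order = p.order := by
  have hunit : IsUnit v := by
    rw [PowerSeries.isUnit_iff_constantCoeff]
    exact isUnit_iff_ne_zero.mpr hv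
  rw [order_mul, order_zero_of_unit hunit, zero_add]

/-- **Depth dichotomy for a 2×2 cancellation.**  Let `u_a, u_b, u_c, u_d ∈ K⟦X⟧` have nonzero
constant terms and let `γ = ord(u_a u_b − u_c u_d)` be finite.  Then either `γ` is CROSS-WITNESSED
(`γ ∈ {δ(a,c), δ(b,d), δ(a,d), δ(b,c)}`, `δ(x,z) = ord(u_x − u_z)`), or the cancellation is RESONANT:
`δ(a,c) = δ(b,d) = g₁`, `δ(a,d) = δ(b,c) = g₂` with `g₁, g₂ < γ`. [folklore] -/
theorem gadget_depth_dichotomy (ua ub uc ud : K⟦X⟧)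
    (ha : constantCoeff ua ≠ 0) (hb : constantCoeff ub ≠ 0) (hc : constantCoeff uc ≠ 0)
    (γ : ℕ) (hγ : (ua * ub - uc * ud).order = γ) :
    ((ua - uc).order = γ ∨ (ub - ud).order = γ ∨ (ua - ud).order = γ ∨ (ub - uc).order = γ) ∨
      ∃ g₁ g₂ : ℕ, (ua - uc).order = g₁ ∧ (ub - ud).order = g₁ ∧ (ua - ud).order = g₂ ∧
        (ub - uc).order = g₂ ∧ g₁ < γ ∧ g₂ < γ := by
  -- the two cross forms
  have hA : ua * ub - uc * ud = ub * (ua - uc) + uc * (ub - ud) := by ring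
  have hB : ua * ub - uc * ud = ua * (ub - uc) + uc * (ua - ud) := by ring
  have oA1 : (ub * (ua - uc)).order = (ua - uc).order := order_mul_of_constantCoeff_ne_zero _ _ hb
  have oA2 : (uc * (ub - ud)).order = (ub - ud).order := order_mul_of_constantCoeff_ne_zero _ _ hc
  have oB1 : (ua * (ub - uc)).order = (ub - uc).order := order_mul_of_constantCoeff_ne_zero _ _ ha
  have oB2 : (uc * (ua - ud)).order = (ua - ud).order := order_mul_of_constantCoeff_ne_zero _ _ hc
  -- first matching: different orders ⇒ cross witness
  by_cases h1 : (ua - uc).order = (ub - ud).order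
  swap
  · left
    have hne : (ub * (ua - uc)).order ≠ (uc * (ub - ud)).order := by rwa [oA1, oA2]
    have hsum := order_add_of_order_ne _ _ hne
    rw [← hA, hγ, oA1, oA2] at hsum
    rcases min_choice (ua - uc).order (ub - ud).order with h | h
    · exact Or.inl (by rw [← h, ← hsum])
    · exact Or.inr (Or.inl (by rw [← h, ← hsum]))
  -- second matching: different orders ⇒ cross witness
  by_cases h2 : (ua - ud).order = (ub - uc).order
  swap
  · left
    have hne : (ua * (ub - uc)).order ≠ (uc * (ua - ud)).order := by
      rw [oB1, oB2]; exact fun h => h2 h.symm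
    have hsum := order_add_of_order_ne _ _ hne
    rw [← hB, hγ, oB1, oB2] at hsum
    rcases min_choice (ub - uc).order (ua - ud).order with h | h
    · exact Or.inr (Or.inr (Or.inr (by rw [← h, ← hsum])))
    · exact Or.inr (Or.inr (Or.inl (by rw [← h, ← hsum])))
  -- both matchings isosceles: the two common values are ≤ γ, hence finite
  obtain ⟨hge1, _⟩ := order_gadget_ge ua ub uc ud
  rw [hγ, ← h1, min_self] at hge1
  have hge2 : (ua - ud).order ≤ (γ : ℕ∞) := by
    have h := (order_gadget_ge ua ub ud uc).1
    -- `ua * ub - ud * uc` has the same order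
    rw [show ua * ub - ud * uc = ua * ub - uc * ud by ring, hγ, h2, min_self] at h
    rwa [h2]
  -- name the finite values
  obtain ⟨g₁, hg₁⟩ : ∃ g₁ : ℕ, (ua - uc).order = g₁ :=
    ENat.ne_top_iff_exists.mp (ne_top_of_le_ne_top (ENat.coe_ne_top γ) hge1) |>.imp fun _ h => h.symm
  obtain ⟨g₂, hg₂⟩ : ∃ g₂ : ℕ, (ua - ud).order = g₂ :=
    ENat.ne_top_iff_exists.mp (ne_top_of_le_ne_top (ENat.coe_ne_top γ) hge2) |>.imp fun _ h => h.symm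
  rw [hg₁] at hge1
  rw [hg₂] at hge2
  have hle1 : g₁ ≤ γ := by exact_mod_cast hge1
  have hle2 : g₂ ≤ γ := by exact_mod_cast hge2
  rcases Nat.lt_or_ge g₁ γ with hlt1 | hge1'
  · rcases Nat.lt_or_ge g₂ γ with hlt2 | hge2'
    · right
      exact ⟨g₁, g₂, hg₁, by rw [← h1, hg₁], hg₂, by rw [← h2, hg₂], hlt1, hlt2⟩
    · left
      have : g₂ = γ := le_antisymm hle2 hge2'
      exact Or.inr (Or.inr (Or.inl (by rw [hg₂, this])))
  · left
    have : g₁ = γ := le_antisymm hle1 hge1'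
    exact Or.inl (by rw [hg₁, this])

end Dichotomy

/-- **Registered helper stub `helper_depthDichotomy`** (crux stmt-ValiantsHypothesis-6534, line
`registered`): `gadget_depth_dichotomy` over `ℂ` with all binders — a finite 2×2 depth is cross-witnessed
or resonant with both isosceles values strictly smaller. [folklore] -/
theorem helper_depthDichotomy : ∀ (ua ub uc ud : PowerSeries ℂ) (γ : ℕ), PowerSeries.constantCoeff ua ≠ 0 → PowerSeries.constantCoeff ub ≠ 0 → PowerSeries.constantCoeff uc ≠ 0 → (ua * ub - uc * ud).order = (γ : ℕ∞) → (((ua - uc).order = (γ : ℕ∞) ∨ (ub - ud).order = (γ : ℕ∞) ∨ (ua - ud).order = (γ : ℕ∞) ∨ (ub - uc).order = (γ : ℕ∞)) ∨ ∃ g₁ g₂ : ℕ, (ua - uc).order = (g₁ : ℕ∞) ∧ (ub - ud).order = (g₁ : ℕ∞) ∧ (ua - ud).order = (g₂ : ℕ∞) ∧ (ub - uc).order = (g₂ : ℕ∞) ∧ g₁ < γ ∧ g₂ < γ) :=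
  fun ua ub uc ud γ ha hb hc hγ => gadget_depth_dichotomy ua ub uc ud ha hb hc γ hγ

end Summit.ValiantsHypothesis.ValiantsHypothesis.Theorems
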